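import Mathlib.Tactic
import Summits.CriticalPhenomena.PercolationContinuityZ3.Theorems.PercNearOneGluingNoHeavyLowerTailMultiTypeLSM
import HarnessLib

/-!
# Sheared LSM inequalities (X1, X2) for every multi-type de Finetti law with integer rates

Support file for the Sahi / Conjecture-P programme of route `PercNearOneGluingNoHeavy`
(`--supports stmt-CriticalPhenomena-4575`, prover prim-l12-p5 gen 32; proof note
`prim-l12-p5/INVARIANT-S-g32.md`).  No definitions, no named facts, no sorries.

SITE MODEL (as in `…LowerTailMultiTypeLSM`): `T` copies with weights `(1, p_τ, q_τ)` for the states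
`(0, X, Y)` and `m` NEUTRAL sites with weights `(1, 1, 1)`;
`A_m(a,c) = Σ { w(κ) : κ : Fin T ⊕ Fin m → {0,X,Y}, #X = a, #Y = c } = [u^a v^c] ∏_τ (1 + p_τ u + q_τ v) (1 + u + v)^m`.
THEOREM MT (`MultiTypeLSM.multiType_lsm`) is the log-supermodularity
`A_{n+1}(a+1,c) A_{n+1}(a,c+1) ≤ A_{n+2}(a+1,c+1) A_n(a,c)` ("diagonal shear").  The present file adds the two
SHEARED companions, which together with MT form the invariant `S = {P, X1, X2}` of the gen-32 note:

* **X1** (`multiType_shearX`, needs `p_τ ≤ 1`):  `A_{m+1}(i, l+1) · A_m(i+1, l) ≤ A_m(i, l) · A_{m+1}(i+1, l+1)`;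
* **X2** (`multiType_shearY`, needs `q_τ ≤ 1`):  `A_{m+1}(i+1, l) · A_m(i, l+1) ≤ A_m(i, l) · A_{m+1}(i+1, l+1)`.

In words (X1): with `m + 1` neutral sites and quotas `(i+1, l+1)`, lowering the `X`-quota by one makes a
neutral site MORE likely to be in state `Y`; equivalently, for the cycle partition functions with an Ewens
component `β`, `Zc^β(a+1,c+1) Zc^{β+1}(a,c) ≥ Zc^β(a+1,c) Zc^{β+1}(a,c+1)` ("the odd `y` prefers the system
holding the odd `x` to the system holding an anchor").

Proof of X1: add an AUXILIARY COPY `τ₀` with weights `(1, 1, 0)` (it can be empty or `X`, never `Y`).  In the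
model with `T+1` copies, `m+1` neutral sites and quotas `(i+1, l+1)`, THEOREM COV
(`SiteCovariance.site_covariance`, the `Y`-site being a neutral site, whose `X`-weight `1` is maximal since
`p_τ ≤ 1`) gives `W(τ₀ = X) · W(s = Y) ≤ W(τ₀ = X ∧ s = Y) · W(all)`; removing `τ₀` (`remove_first`) and the
neutral site `s` (`MultiTypeLSM.remove_last`) turns the four weights into
`A_{m+1}(i,l+1)`, `A_m(i+1,l) + A_m(i,l)`, `A_m(i,l)`, `A_{m+1}(i+1,l+1) + A_{m+1}(i,l+1)`, and the cross terms
cancel.  X2 is the `X ↔ Y` mirror (`MultiTypeLSM.relabel`).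

* `card_state_first`, `remove_first`, `split_first` : reindexing lemmas for the first copy;
* `multiType_shearX` : X1;  `multiType_shearY` : X2.
-/

namespace Summit.CriticalPhenomena.PercolationContinuityZ3.Theorems

namespace MultiTypeShear

open Finset

variable {T : ℕ}

/-- Counting states on `Fin (T+1) ⊕ Fin m`: split off the first copy. -/
theorem card_state_first (m : ℕ) (κ : Fin (T + 1) ⊕ Fin m → Fin 3) (v : Fin 3) :
    (univ.filter (fun s => κ s = v)).card =
      (univ.filter (fun s : Fin T ⊕ Fin m => κ (Sum.map Fin.succ id s) = v)).card +
        (if κ (Sum.inl 0) = v then 1 else 0) := by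
  rw [Finset.card_filter, Finset.card_filter, Fintype.sum_sum_type, Fintype.sum_sum_type,
    Fin.sum_univ_succ]
  simp only [Sum.map_inl, Sum.map_inr, id_eq]
  ring

/-- **Removing the first copy.**  Configurations on `Fin (T+1) ⊕ Fin m` whose first copy is in state
`v`, with quotas `(x', y')` and a further constraint on the remaining sites, correspond to configurations
on `Fin T ⊕ Fin m` with quotas `(x, y)`, `x' = x + [v = X]`, `y' = y + [v = Y]`; the weight picks up the
factor `(1, p'₀, q'₀)(v)` of the removed copy. -/
theorem remove_first (p' q' : Fin (T + 1) → ℝ) (m : ℕ) (v : Fin 3) (x y x' y' : ℕ)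
    (hx : x' = x + (if v = 1 then 1 else 0)) (hy : y' = y + (if v = 2 then 1 else 0))
    (φ : (Fin T ⊕ Fin m → Fin 3) → Prop) [DecidablePred φ] :
    ∑ κ ∈ univ.filter (fun κ : Fin (T + 1) ⊕ Fin m → Fin 3 =>
        ((univ.filter (fun s => κ s = 1)).card = x' ∧ (univ.filter (fun s => κ s = 2)).card = y') ∧
          (κ (Sum.inl 0) = v ∧ φ (fun s => κ (Sum.map Fin.succ id s)))),
        (∏ s, (if κ s = 1 then Sum.elim p' (fun _ => (1:ℝ)) s else if κ s = 2 then Sum.elim q' (fun _ => (1:ℝ)) s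
          else 1)) =
      (if v = 1 then p' 0 else if v = 2 then q' 0 else 1) *
      ∑ κ ∈ univ.filter (fun κ : Fin T ⊕ Fin m → Fin 3 =>
        ((univ.filter (fun s => κ s = 1)).card = x ∧ (univ.filter (fun s => κ s = 2)).card = y) ∧ φ κ),
        (∏ s, (if κ s = 1 then Sum.elim (fun τ => p' τ.succ) (fun _ => (1:ℝ)) s else if κ s = 2 then
          Sum.elim (fun τ => q' τ.succ) (fun _ => (1:ℝ)) s else 1)) := by
  rw [Finset.mul_sum]
  refine Finset.sum_nbij' (fun κ s => κ (Sum.map Fin.succ id s))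
    (fun κ' s => Sum.elim (Fin.cons v (fun τ => κ' (Sum.inl τ))) (fun i => κ' (Sum.inr i)) s)
    ?_ ?_ ?_ ?_ ?_
  · intro κ hκ
    obtain ⟨⟨h1, h2⟩, hv, hφ⟩ := (Finset.mem_filter.1 hκ).2
    refine Finset.mem_filter.2 ⟨Finset.mem_univ _, ⟨?_, ?_⟩, hφ⟩
    · show (univ.filter (fun s : Fin T ⊕ Fin m => κ (Sum.map Fin.succ id s) = 1)).card = x
      have := card_state_first m κ 1
      rw [h1, hv, hx] at this
      omega
    · show (univ.filter (fun s : Fin T ⊕ Fin m => κ (Sum.map Fin.succ id s) = 2)).card = y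
      have := card_state_first m κ 2
      rw [h2, hv, hy] at this
      omega
  · intro κ' hκ'
    obtain ⟨⟨h1, h2⟩, hφ⟩ := (Finset.mem_filter.1 hκ').2
    have hc : ∀ s : Fin T ⊕ Fin m, Sum.elim (Fin.cons v (fun τ => κ' (Sum.inl τ)))
        (fun i => κ' (Sum.inr i)) (Sum.map Fin.succ id s) = κ' s := by
      rintro (τ | i) <;> simp
    have hl : Sum.elim (Fin.cons v (fun τ => κ' (Sum.inl τ))) (fun i => κ' (Sum.inr i))
        (Sum.inl 0 : Fin (T + 1) ⊕ Fin m) = v := by simp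
    refine Finset.mem_filter.2 ⟨Finset.mem_univ _, ⟨?_, ?_⟩, hl, ?_⟩
    · rw [card_state_first, hx]
      simp only [hc, hl, h1]
    · rw [card_state_first, hy]
      simp only [hc, hl, h2]
    · simp only [hc]
      exact hφ
  · intro κ hκ
    obtain ⟨_, hv, _⟩ := (Finset.mem_filter.1 hκ).2
    funext s
    rcases s with τ | i
    · refine Fin.cases ?_ (fun τ' => ?_) τ
      · simp [hv]
      · simp
    · simp
  · intro κ' _
    funext s
    rcases s with τ | i <;> simp
  · intro κ hκ
    obtain ⟨_, hv, _⟩ := (Finset.mem_filter.1 hκ).2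
    rw [MultiTypeLSM.weight_copies, MultiTypeLSM.weight_copies, Fin.prod_univ_succ, hv]
    congr 1

/-- Splitting a conditioned weight sum on `Fin (T+1) ⊕ Fin m` according to the state of the first copy. -/
theorem split_first (m : ℕ) (C : (Fin (T + 1) ⊕ Fin m → Fin 3) → Prop) [DecidablePred C]
    (f : (Fin (T + 1) ⊕ Fin m → Fin 3) → ℝ) :
    ∑ κ ∈ univ.filter (fun κ => C κ), f κ =
      ∑ κ ∈ univ.filter (fun κ => C κ ∧ κ (Sum.inl 0) = 0), f κ +
      ∑ κ ∈ univ.filter (fun κ => C κ ∧ κ (Sum.inl 0) = 1), f κ +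
      ∑ κ ∈ univ.filter (fun κ => C κ ∧ κ (Sum.inl 0) = 2), f κ := by
  rw [← Finset.sum_fiberwise_of_maps_to (s := univ.filter (fun κ => C κ)) (t := (univ : Finset (Fin 3)))
    (g := fun κ => κ (Sum.inl 0)) (fun _ _ => Finset.mem_univ _)]
  rw [Fin.sum_univ_three]
  simp only [Finset.filter_filter]

/-- **X1 (sheared LSM in the `X` direction).**  For `T` copies with `0 ≤ p_τ ≤ 1`, `0 ≤ q_τ` and the
site sums `A_m(x,y)` (explicit below), for all `i, l, m`:
`A_{m+1}(i, l+1) · A_m(i+1, l) ≤ A_m(i, l) · A_{m+1}(i+1, l+1)`. -/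
theorem multiType_shearX (p q : Fin T → ℝ) (hp0 : ∀ τ, 0 ≤ p τ) (hp1 : ∀ τ, p τ ≤ 1) (hq : ∀ τ, 0 ≤ q τ)
    (i l m : ℕ) :
    (∑ κ ∈ univ.filter (fun κ : Fin T ⊕ Fin (m + 1) → Fin 3 =>
        (univ.filter (fun s => κ s = 1)).card = i ∧ (univ.filter (fun s => κ s = 2)).card = l + 1),
        (∏ s, (if κ s = 1 then Sum.elim p (fun _ => (1:ℝ)) s else if κ s = 2 then Sum.elim q (fun _ => (1:ℝ)) s
          else 1))) *
      (∑ κ ∈ univ.filter (fun κ : Fin T ⊕ Fin m → Fin 3 =>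
        (univ.filter (fun s => κ s = 1)).card = i + 1 ∧ (univ.filter (fun s => κ s = 2)).card = l),
        (∏ s, (if κ s = 1 then Sum.elim p (fun _ => (1:ℝ)) s else if κ s = 2 then Sum.elim q (fun _ => (1:ℝ)) s
          else 1))) ≤
    (∑ κ ∈ univ.filter (fun κ : Fin T ⊕ Fin m → Fin 3 =>
        (univ.filter (fun s => κ s = 1)).card = i ∧ (univ.filter (fun s => κ s = 2)).card = l),
        (∏ s, (if κ s = 1 then Sum.elim p (fun _ => (1:ℝ)) s else if κ s = 2 then Sum.elim q (fun _ => (1:ℝ)) s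
          else 1))) *
      (∑ κ ∈ univ.filter (fun κ : Fin T ⊕ Fin (m + 1) → Fin 3 =>
        (univ.filter (fun s => κ s = 1)).card = i + 1 ∧ (univ.filter (fun s => κ s = 2)).card = l + 1),
        (∏ s, (if κ s = 1 then Sum.elim p (fun _ => (1:ℝ)) s else if κ s = 2 then Sum.elim q (fun _ => (1:ℝ)) s
          else 1))) := by
  -- auxiliary copy with weights (1, 1, 0) in front
  set p' : Fin (T + 1) → ℝ := Fin.cons 1 p with hp'
  set q' : Fin (T + 1) → ℝ := Fin.cons 0 q with hq'
  have hp's : (fun τ : Fin T => p' τ.succ) = p := by funext τ; simp [hp']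
  have hq's : (fun τ : Fin T => q' τ.succ) = q := by funext τ; simp [hq']
  have hp'0 : p' 0 = 1 := by simp [hp']
  have hq'0 : q' 0 = 0 := by simp [hq']
  -- THEOREM COV on `Fin (T+1) ⊕ Fin (m+1)`: `X`-site = the auxiliary copy, `Y`-site = the last neutral site
  have hP : ∀ s : Fin (T + 1) ⊕ Fin (m + 1), 0 ≤ Sum.elim p' (fun _ => (1:ℝ)) s := by
    rintro (τ | j)
    · refine Fin.cases ?_ (fun τ' => ?_) τ
      · simp [hp']
      · simpa [hp'] using hp0 τ'
    · exact zero_le_one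
  have hQ : ∀ s : Fin (T + 1) ⊕ Fin (m + 1), 0 ≤ Sum.elim q' (fun _ => (1:ℝ)) s := by
    rintro (τ | j)
    · refine Fin.cases ?_ (fun τ' => ?_) τ
      · simp [hq']
      · simpa [hq'] using hq τ'
    · exact zero_le_one
  have hmax : ∀ s : Fin (T + 1) ⊕ Fin (m + 1),
      Sum.elim p' (fun _ => (1:ℝ)) s ≤ Sum.elim p' (fun _ => (1:ℝ)) (Sum.inr (Fin.last m)) := by
    rintro (τ | j)
    · refine Fin.cases ?_ (fun τ' => ?_) τ
      · simp [hp']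
      · simpa [hp'] using hp1 τ'
    · exact le_rfl
  have hne : (Sum.inl 0 : Fin (T + 1) ⊕ Fin (m + 1)) ≠ Sum.inr (Fin.last m) := by simp
  have COV := SiteCovariance.site_covariance (Sum.elim p' (fun _ => (1:ℝ))) (Sum.elim q' (fun _ => (1:ℝ)))
    hP hQ _ _ hne hmax (i + 1) (l + 1)
  -- abbreviations for the `T`-copy site sums
  -- (1) W(aux = X) = A_{m+1}(i, l+1)
  have hX : ∑ κ ∈ univ.filter (fun κ : Fin (T + 1) ⊕ Fin (m + 1) → Fin 3 =>
        ((univ.filter (fun s => κ s = 1)).card = i + 1 ∧ (univ.filter (fun s => κ s = 2)).card = l + 1) ∧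
          κ (Sum.inl 0) = 1),
        (∏ s, (if κ s = 1 then Sum.elim p' (fun _ => (1:ℝ)) s else if κ s = 2 then Sum.elim q' (fun _ => (1:ℝ)) s
          else 1)) =
      ∑ κ ∈ univ.filter (fun κ : Fin T ⊕ Fin (m + 1) → Fin 3 =>
        (univ.filter (fun s => κ s = 1)).card = i ∧ (univ.filter (fun s => κ s = 2)).card = l + 1),
        (∏ s, (if κ s = 1 then Sum.elim p (fun _ => (1:ℝ)) s else if κ s = 2 then Sum.elim q (fun _ => (1:ℝ)) s
          else 1)) := by
    have r := remove_first p' q' (m + 1) 1 i (l + 1) (i + 1) (l + 1) (by simp) (by simp) (fun _ => True)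
    rw [hp's, hq's, hp'0] at r
    simp only [Fin.isValue, ↓reduceIte, one_mul, and_true] at r
    refine (Finset.sum_congr (Finset.filter_congr fun κ _ => ?_) fun _ _ => rfl).trans r
    simp
  -- weights of configurations whose auxiliary copy is `Y` vanish (`q'₀ = 0`)
  have hzero : ∀ (m' : ℕ) (C : (Fin (T + 1) ⊕ Fin m' → Fin 3) → Prop) [DecidablePred C],
      ∑ κ ∈ univ.filter (fun κ : Fin (T + 1) ⊕ Fin m' → Fin 3 => C κ ∧ κ (Sum.inl 0) = 2),
        (∏ s, (if κ s = 1 then Sum.elim p' (fun _ => (1:ℝ)) s else if κ s = 2 then Sum.elim q' (fun _ => (1:ℝ)) s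
          else 1)) = 0 := by
    intro m' C _
    refine Finset.sum_eq_zero fun κ hκ => ?_
    obtain ⟨_, h2⟩ := (Finset.mem_filter.1 hκ).2
    rw [MultiTypeLSM.weight_copies, Fin.prod_univ_succ, h2]
    simp [hq'0]
  -- (2) W(last neutral = Y) = A_m(i+1, l) + A_m(i, l)
  have hY : ∑ κ ∈ univ.filter (fun κ : Fin (T + 1) ⊕ Fin (m + 1) → Fin 3 =>
        ((univ.filter (fun s => κ s = 1)).card = i + 1 ∧ (univ.filter (fun s => κ s = 2)).card = l + 1) ∧
          κ (Sum.inr (Fin.last m)) = 2),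
        (∏ s, (if κ s = 1 then Sum.elim p' (fun _ => (1:ℝ)) s else if κ s = 2 then Sum.elim q' (fun _ => (1:ℝ)) s
          else 1)) =
      ∑ κ ∈ univ.filter (fun κ : Fin T ⊕ Fin m → Fin 3 =>
        (univ.filter (fun s => κ s = 1)).card = i + 1 ∧ (univ.filter (fun s => κ s = 2)).card = l),
        (∏ s, (if κ s = 1 then Sum.elim p (fun _ => (1:ℝ)) s else if κ s = 2 then Sum.elim q (fun _ => (1:ℝ)) s
          else 1)) +
      ∑ κ ∈ univ.filter (fun κ : Fin T ⊕ Fin m → Fin 3 =>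
        (univ.filter (fun s => κ s = 1)).card = i ∧ (univ.filter (fun s => κ s = 2)).card = l),
        (∏ s, (if κ s = 1 then Sum.elim p (fun _ => (1:ℝ)) s else if κ s = 2 then Sum.elim q (fun _ => (1:ℝ)) s
          else 1)) := by
    have r := MultiTypeLSM.remove_last p' q' m 2 (i + 1) l (i + 1) (l + 1) (by simp) (by simp) (fun _ => True)
    have e0 := remove_first p' q' m 0 (i + 1) l (i + 1) l (by simp) (by simp) (fun _ => True)
    have e1 := remove_first p' q' m 1 i l (i + 1) l (by simp) (by simp) (fun _ => True)
    have e2 := hzero m (fun κ => (univ.filter (fun s => κ s = 1)).card = i + 1 ∧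
      (univ.filter (fun s => κ s = 2)).card = l)
    rw [hp's, hq's] at e0 e1
    rw [hp'0] at e1
    simp only [Fin.isValue, Fin.reduceEq, ↓reduceIte, one_mul, and_true] at r e0 e1
    rw [r, split_first m (fun κ : Fin (T + 1) ⊕ Fin m → Fin 3 =>
        (univ.filter (fun s => κ s = 1)).card = i + 1 ∧ (univ.filter (fun s => κ s = 2)).card = l), e0, e1, e2,
      add_zero]
  -- (3) W(aux = X ∧ last neutral = Y) = A_m(i, l)
  have hXY : ∑ κ ∈ univ.filter (fun κ : Fin (T + 1) ⊕ Fin (m + 1) → Fin 3 =>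
        ((univ.filter (fun s => κ s = 1)).card = i + 1 ∧ (univ.filter (fun s => κ s = 2)).card = l + 1) ∧
          (κ (Sum.inl 0) = 1 ∧ κ (Sum.inr (Fin.last m)) = 2)),
        (∏ s, (if κ s = 1 then Sum.elim p' (fun _ => (1:ℝ)) s else if κ s = 2 then Sum.elim q' (fun _ => (1:ℝ)) s
          else 1)) =
      ∑ κ ∈ univ.filter (fun κ : Fin T ⊕ Fin m → Fin 3 =>
        (univ.filter (fun s => κ s = 1)).card = i ∧ (univ.filter (fun s => κ s = 2)).card = l),
        (∏ s, (if κ s = 1 then Sum.elim p (fun _ => (1:ℝ)) s else if κ s = 2 then Sum.elim q (fun _ => (1:ℝ)) s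
          else 1)) := by
    have r := MultiTypeLSM.remove_last p' q' m 2 (i + 1) l (i + 1) (l + 1) (by simp) (by simp)
      (fun κ' => κ' (Sum.inl 0) = 1)
    have e1 := remove_first p' q' m 1 i l (i + 1) l (by simp) (by simp) (fun _ => True)
    rw [hp's, hq's, hp'0] at e1
    simp only [Fin.isValue, ↓reduceIte, one_mul, and_true] at e1
    refine (Finset.sum_congr (Finset.filter_congr fun κ _ => ?_) fun _ _ => rfl).trans
      (r.trans ((Finset.sum_congr (Finset.filter_congr fun κ _ => ?_) fun _ _ => rfl).trans e1))
    · simp only [Sum.map_inl, id_eq]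
      tauto
    · simp
  -- (4) W(all) = A_{m+1}(i+1, l+1) + A_{m+1}(i, l+1)
  have hAll : ∑ κ ∈ univ.filter (fun κ : Fin (T + 1) ⊕ Fin (m + 1) → Fin 3 =>
        (univ.filter (fun s => κ s = 1)).card = i + 1 ∧ (univ.filter (fun s => κ s = 2)).card = l + 1),
        (∏ s, (if κ s = 1 then Sum.elim p' (fun _ => (1:ℝ)) s else if κ s = 2 then Sum.elim q' (fun _ => (1:ℝ)) s
          else 1)) =
      ∑ κ ∈ univ.filter (fun κ : Fin T ⊕ Fin (m + 1) → Fin 3 =>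
        (univ.filter (fun s => κ s = 1)).card = i + 1 ∧ (univ.filter (fun s => κ s = 2)).card = l + 1),
        (∏ s, (if κ s = 1 then Sum.elim p (fun _ => (1:ℝ)) s else if κ s = 2 then Sum.elim q (fun _ => (1:ℝ)) s
          else 1)) +
      ∑ κ ∈ univ.filter (fun κ : Fin T ⊕ Fin (m + 1) → Fin 3 =>
        (univ.filter (fun s => κ s = 1)).card = i ∧ (univ.filter (fun s => κ s = 2)).card = l + 1),
        (∏ s, (if κ s = 1 then Sum.elim p (fun _ => (1:ℝ)) s else if κ s = 2 then Sum.elim q (fun _ => (1:ℝ)) s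
          else 1)) := by
    have e0 := remove_first p' q' (m + 1) 0 (i + 1) (l + 1) (i + 1) (l + 1) (by simp) (by simp) (fun _ => True)
    have e1 := remove_first p' q' (m + 1) 1 i (l + 1) (i + 1) (l + 1) (by simp) (by simp) (fun _ => True)
    have e2 := hzero (m + 1) (fun κ => (univ.filter (fun s => κ s = 1)).card = i + 1 ∧
      (univ.filter (fun s => κ s = 2)).card = l + 1)
    rw [hp's, hq's] at e0 e1
    rw [hp'0] at e1
    simp only [Fin.isValue, Fin.reduceEq, ↓reduceIte, one_mul, and_true] at e0 e1
    rw [split_first (m + 1) (fun κ : Fin (T + 1) ⊕ Fin (m + 1) → Fin 3 =>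
        (univ.filter (fun s => κ s = 1)).card = i + 1 ∧ (univ.filter (fun s => κ s = 2)).card = l + 1),
      e0, e1, e2, add_zero]
  rw [hX, hY, hXY, hAll] at COV
  nlinarith [COV]

/-- **X2 (sheared LSM in the `Y` direction)**, the `X ↔ Y` mirror of `multiType_shearX`: for `T` copies with
`0 ≤ p_τ`, `0 ≤ q_τ ≤ 1` and all `i, l, m`:
`A_{m+1}(i+1, l) · A_m(i, l+1) ≤ A_m(i, l) · A_{m+1}(i+1, l+1)`. -/
theorem multiType_shearY (p q : Fin T → ℝ) (hp : ∀ τ, 0 ≤ p τ) (hq0 : ∀ τ, 0 ≤ q τ) (hq1 : ∀ τ, q τ ≤ 1)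
    (i l m : ℕ) :
    (∑ κ ∈ univ.filter (fun κ : Fin T ⊕ Fin (m + 1) → Fin 3 =>
        (univ.filter (fun s => κ s = 1)).card = i + 1 ∧ (univ.filter (fun s => κ s = 2)).card = l),
        (∏ s, (if κ s = 1 then Sum.elim p (fun _ => (1:ℝ)) s else if κ s = 2 then Sum.elim q (fun _ => (1:ℝ)) s
          else 1))) *
      (∑ κ ∈ univ.filter (fun κ : Fin T ⊕ Fin m → Fin 3 =>
        (univ.filter (fun s => κ s = 1)).card = i ∧ (univ.filter (fun s => κ s = 2)).card = l + 1),
        (∏ s, (if κ s = 1 then Sum.elim p (fun _ => (1:ℝ)) s else if κ s = 2 then Sum.elim q (fun _ => (1:ℝ)) s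
          else 1))) ≤
    (∑ κ ∈ univ.filter (fun κ : Fin T ⊕ Fin m → Fin 3 =>
        (univ.filter (fun s => κ s = 1)).card = i ∧ (univ.filter (fun s => κ s = 2)).card = l),
        (∏ s, (if κ s = 1 then Sum.elim p (fun _ => (1:ℝ)) s else if κ s = 2 then Sum.elim q (fun _ => (1:ℝ)) s
          else 1))) *
      (∑ κ ∈ univ.filter (fun κ : Fin T ⊕ Fin (m + 1) → Fin 3 =>
        (univ.filter (fun s => κ s = 1)).card = i + 1 ∧ (univ.filter (fun s => κ s = 2)).card = l + 1),
        (∏ s, (if κ s = 1 then Sum.elim p (fun _ => (1:ℝ)) s else if κ s = 2 then Sum.elim q (fun _ => (1:ℝ)) s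
          else 1))) := by
  have h := multiType_shearX q p hq0 hq1 hp l i m
  rw [MultiTypeLSM.relabel (P := (Sum.elim p (fun _ => (1:ℝ)) : Fin T ⊕ Fin (m + 1) → ℝ))
      (Q := (Sum.elim q (fun _ => (1:ℝ)) : Fin T ⊕ Fin (m + 1) → ℝ)) (x := l) (y := i + 1),
    MultiTypeLSM.relabel (P := (Sum.elim p (fun _ => (1:ℝ)) : Fin T ⊕ Fin m → ℝ))
      (Q := (Sum.elim q (fun _ => (1:ℝ)) : Fin T ⊕ Fin m → ℝ)) (x := l + 1) (y := i),
    MultiTypeLSM.relabel (P := (Sum.elim p (fun _ => (1:ℝ)) : Fin T ⊕ Fin m → ℝ))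
      (Q := (Sum.elim q (fun _ => (1:ℝ)) : Fin T ⊕ Fin m → ℝ)) (x := l) (y := i),
    MultiTypeLSM.relabel (P := (Sum.elim p (fun _ => (1:ℝ)) : Fin T ⊕ Fin (m + 1) → ℝ))
      (Q := (Sum.elim q (fun _ => (1:ℝ)) : Fin T ⊕ Fin (m + 1) → ℝ)) (x := l + 1) (y := i + 1)] at h
  exact h

end MultiTypeShear

end Summit.CriticalPhenomena.PercolationContinuityZ3.Theorems
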